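import Mathlib
import Literature.Computability.AlgebraicComplexity.NewtonPolygonTauProductBounds
import Summits.ValiantsHypothesis.ValiantsHypothesis.Theorems.NewtonUnitEquationsDissociatedUniformTotalsLawDominance
import Summits.ValiantsHypothesis.ValiantsHypothesis.Theorems.NewtonUnitEquationsDissociatedUniformTotalsLawBoxWindows
import Summits.ValiantsHypothesis.ValiantsHypothesis.Theorems.NewtonUnitEquationsDissociatedUniformTotalsLawBoxUnion
import Summits.ValiantsHypothesis.ValiantsHypothesis.Theorems.NewtonUnitEquationsDissociatedUniformTotalsLawGridDominance
import HarnessLib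

/-!
# Crux `NewtonUnitEquations.DissociatedUniform` (stmt-ValiantsHypothesis-5905), `n = 3` totals law of model (Q**):
# KEYED GRID DOMINANCE ⇒ THE BOX STRATUM IS LOG-FREE (conditional rung link)

Memo `Cruxes/DissociatedUniform/NOTES-t1g18.md` §3.  The box stratum (`…TotalsLawBoxUnion.unionVert_cycBox_le`: `#vert conv U_s(Z) ≤ 80K|G|`
for boxes `Z ⊂ ℤ/q₁ × ℤ/q₂`, `K = O(log |G|)`) is proved through the dominance hull bound, whose logarithm cannot be removed for
general dominance sums (memo §2).  The block reduction of `…TotalsLawBoxWindows` actually produces KEYED grid-dominance pieces: rows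
keyed injectively by `(l₁ mod m₁, l₂ mod m₂) ∈ [m₁] × [m₂]`, columns keyed injectively by the cell offset, relation per coordinate
`key ≤ cell` (suffix piece) or `cell < key` (prefix piece).  This file types that form of the located rung and proves the link:
* `Stair.keyPts` — the keyed dominance sum with suffix/prefix flags; `GridDominanceKeyBound C` — for injectively keyed
  rows and columns with keys `< (M₁, M₂)`, `#vert conv(keyPts) ≤ C·M₁M₂` (conjecture-grade, OPEN; it contains `GridDominanceSubBound` /
  `GridDominanceBound` of `…GridDominance(Sub)`, which are its flag-free instances);
* `BoxWin.boxPiece_eq_keyPts` — every piece of the block decomposition IS a keyed grid-dominance sum (keys injective when the window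
  corners are injective, `BoxWin.keyRow_injOn`);
* `BoxWin.ncard_extremePoints_boxWindows_le_of_keyBound` — **`GridDominanceKeyBound C ⇒ #vert conv ⋃ᵢ(v i + b[box i]) ≤ 4C·m₁m₂·#blocks`**
  (no logarithm, no row term) for injective corners;
* `unionVert_cycBox_le_of_keyBound` — **`GridDominanceKeyBound C ⇒ #vert conv U_s(Z) ≤ 16C·|G|`** for every box `Z`, every class `s`
  and all `a b` (the window corners `x ↦ winStart` are injective): the box stratum becomes log-free under the rung.
Honest label: a conditional stratum theorem (rung link); `GridDominanceKeyBound` is NOT proved; `UnionTotalsLaw C`, `TriWordsBound C`,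
`TotalsLawThree C` remain OPEN and are asserted nowhere; nothing here bears on VP ≠ VNP. [folklore]
-/

set_option linter.dupNamespace false -- `ValiantsHypothesis.ValiantsHypothesis` (summit = problem) in every name

open Finset Matrix
open scoped Pointwise

namespace Summit.ValiantsHypothesis.ValiantsHypothesis.Theorems.NewtonUnitEquationsDissociatedUniform

namespace TotalsLaw

open Literature.Computability.AlgebraicComplexity.KPTT.PlanarMinkowski

namespace Stair

/-- The KEYED grid-dominance sum: rows `i ∈ R` with keys `kr i`, columns `j ∈ Cs` with keys `kc j`; per coordinate the relation is
`key ≤ cell` (suffix flag `false`) or `cell < key` (prefix flag `true`). -/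
noncomputable def keyPts {ι κ : Type*} (R : Finset ι) (Cs : Finset κ) (kr : ι → ℕ × ℕ) (kc : κ → ℕ × ℕ) (p₁ p₂ : Bool)
    (v : ι → (Fin 2 → ℝ)) (b : κ → (Fin 2 → ℝ)) : Finset (Fin 2 → ℝ) := by
  classical
  exact ((R ×ˢ Cs).filter fun q => (if p₁ then (kc q.2).1 < (kr q.1).1 else (kr q.1).1 ≤ (kc q.2).1) ∧
    (if p₂ then (kc q.2).2 < (kr q.1).2 else (kr q.1).2 ≤ (kc q.2).2)).image fun q => v q.1 + b q.2

/-- Membership in `keyPts`. [folklore] -/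
theorem mem_keyPts {ι κ : Type*} {R : Finset ι} {Cs : Finset κ} {kr : ι → ℕ × ℕ} {kc : κ → ℕ × ℕ} {p₁ p₂ : Bool}
    {v : ι → (Fin 2 → ℝ)} {b : κ → (Fin 2 → ℝ)} {x : Fin 2 → ℝ} :
    x ∈ keyPts R Cs kr kc p₁ p₂ v b ↔
      ∃ i ∈ R, ∃ j ∈ Cs, (if p₁ then (kc j).1 < (kr i).1 else (kr i).1 ≤ (kc j).1) ∧
        (if p₂ then (kc j).2 < (kr i).2 else (kr i).2 ≤ (kc j).2) ∧ v i + b j = x := by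
  classical
  unfold keyPts
  constructor
  · intro hx
    obtain ⟨q, hq, rfl⟩ := Finset.mem_image.1 hx
    obtain ⟨hRC, h1, h2⟩ := Finset.mem_filter.1 hq
    obtain ⟨hi, hj⟩ := Finset.mem_product.1 hRC
    exact ⟨q.1, hi, q.2, hj, h1, h2, rfl⟩
  · rintro ⟨i, hi, j, hj, h1, h2, rfl⟩
    exact Finset.mem_image.2 ⟨(i, j), Finset.mem_filter.2 ⟨Finset.mem_product.2 ⟨hi, hj⟩, h1, h2⟩, rfl⟩

end Stair

/-- **The keyed grid-dominance bound** (conjecture-grade, OPEN, located in memo `NOTES-t1g18.md` §3; the flag-free full-grid instance is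
`GridDominanceBound` of `…TotalsLawGridDominance`, annealed census `#vert/(2m₁m₂) ≈ 1.3`): for rows and columns keyed INJECTIVELY into the
grid `[M₁] × [M₂]` and any suffix/prefix flags, `#vert conv(keyPts) ≤ C·M₁M₂` — the bound is the grid AREA (with `#R + #C` in its place the
statement is false asymptotically, memo §2).  Not asserted anywhere. -/
@[conjecture] def GridDominanceKeyBound (C : ℕ) : Prop :=
  ∀ (ι κ : Type) (R : Finset ι) (Cs : Finset κ) (kr : ι → ℕ × ℕ) (kc : κ → ℕ × ℕ) (M₁ M₂ : ℕ),
    Set.InjOn kr R → Set.InjOn kc Cs → (∀ i ∈ R, (kr i).1 < M₁ ∧ (kr i).2 < M₂) → (∀ j ∈ Cs, (kc j).1 < M₁ ∧ (kc j).2 < M₂) →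
      ∀ (p₁ p₂ : Bool) (v : ι → (Fin 2 → ℝ)) (b : κ → (Fin 2 → ℝ)),
        ((convexHull ℝ (Stair.keyPts R Cs kr kc p₁ p₂ v b : Set (Fin 2 → ℝ))).extremePoints ℝ).ncard ≤ C * (M₁ * M₂)

/-- Monotonicity in the constant. -/
theorem gridDominanceKeyBound_mono {C C' : ℕ} (hCC' : C ≤ C') (h : GridDominanceKeyBound C) : GridDominanceKeyBound C' :=
  fun ι κ R Cs kr kc M₁ M₂ h1 h2 h3 h4 p₁ p₂ v b => (h ι κ R Cs kr kc M₁ M₂ h1 h2 h3 h4 p₁ p₂ v b).trans (Nat.mul_le_mul_right _ hCC')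

/-- **The keyed rung contains the full-grid rung** `GridDominanceBound` of `…TotalsLawGridDominance` (keys = the grid coordinates,
suffix flags). -/
theorem gridDominanceBound_of_keyBound {C : ℕ} (h : GridDominanceKeyBound C) : GridDominanceBound C := by
  classical
  intro m₁ m₂ v b
  have e : Stair.gridPts m₁ m₂ v b =
      Stair.keyPts (Finset.univ : Finset (Fin m₁ × Fin m₂)) Finset.univ (fun k => ((k.1 : ℕ), (k.2 : ℕ)))
        (fun c => ((c.1 : ℕ), (c.2 : ℕ))) false false v b := by
    ext x
    rw [Stair.mem_gridPts, Stair.mem_keyPts]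
    simp only [Finset.mem_univ, true_and, Bool.false_eq_true, if_false, Fin.le_iff_val_le_val]
  rw [e]
  refine h (Fin m₁ × Fin m₂) (Fin m₁ × Fin m₂) Finset.univ Finset.univ _ _ m₁ m₂ ?_ ?_ (fun k _ => ⟨k.1.isLt, k.2.isLt⟩)
    (fun c _ => ⟨c.1.isLt, c.2.isLt⟩) false false v b
  · intro k _ k' _ hk
    simp only [Prod.mk.injEq] at hk
    exact Prod.ext (Fin.ext hk.1) (Fin.ext hk.2)
  · intro c _ c' _ hc
    simp only [Prod.mk.injEq] at hc
    exact Prod.ext (Fin.ext hc.1) (Fin.ext hc.2)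

/-! ### The pieces of the box-window block decomposition are keyed grid-dominance sums -/

namespace BoxWin

variable {ι : Type} [Fintype ι]

/-- The row key `(l₁ i mod m₁, l₂ i mod m₂)` of a translate. -/
def keyRow (l₁ l₂ : ι → ℕ) (m₁ m₂ : ℕ) (i : ι) : ℕ × ℕ := (l₁ i % m₁, l₂ i % m₂)

/-- The column key `(n mod m₁, n / m₁)` of a block offset code `n`. -/
def keyCol (m₁ : ℕ) (n : ℕ) : ℕ × ℕ := (n % m₁, n / m₁)

/-- **Every piece is a keyed grid-dominance sum.** [folklore] -/
theorem boxPiece_eq_keyPts (b : ℕ × ℕ → (Fin 2 → ℝ)) (v : ι → (Fin 2 → ℝ)) (l₁ l₂ : ι → ℕ) {m₁ m₂ : ℕ} (hm₁ : 0 < m₁)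
    (hm₂ : 0 < m₂) (tp : (ℕ × ℕ) × (Bool × Bool)) :
    boxPiece b v l₁ l₂ m₁ m₂ tp =
      Stair.keyPts (boxRows l₁ l₂ m₁ m₂ tp.1) (Finset.univ : Finset (Fin (m₁ * m₂))) (keyRow l₁ l₂ m₁ m₂)
        (fun n => keyCol m₁ (n : ℕ)) tp.2.1 tp.2.2 v
        fun n => b ((tp.1.1 + if tp.2.1 then 1 else 0) * m₁ + (n : ℕ) % m₁, (tp.1.2 + if tp.2.2 then 1 else 0) * m₂ + (n : ℕ) / m₁) := by
  ext x
  rw [boxPiece, Stair.mem_domPts, Stair.mem_keyPts]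
  constructor
  · rintro ⟨i, hi, n, hn, h1, h2, h⟩
    refine ⟨i, hi, n, hn, ?_, ?_, h⟩
    · exact (rpos₁_lt_cpos₁_iff l₁ hm₁ tp.2.1 i (n : ℕ)).1 h1
    · exact (rpos₂_lt_cpos₂_iff l₂ hm₁ hm₂ tp.2.2 i n.isLt).1 h2
  · rintro ⟨i, hi, n, hn, h1, h2, h⟩
    refine ⟨i, hi, n, hn, ?_, ?_, h⟩
    · exact (rpos₁_lt_cpos₁_iff l₁ hm₁ tp.2.1 i (n : ℕ)).2 h1
    · exact (rpos₂_lt_cpos₂_iff l₂ hm₁ hm₂ tp.2.2 i n.isLt).2 h2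

/-- Row keys are injective on a block when the window corners are injective. [folklore] -/
theorem keyRow_injOn (l₁ l₂ : ι → ℕ) (m₁ m₂ : ℕ) (hinj : ∀ i i', l₁ i = l₁ i' → l₂ i = l₂ i' → i = i') (t : ℕ × ℕ) :
    Set.InjOn (keyRow l₁ l₂ m₁ m₂) (boxRows l₁ l₂ m₁ m₂ t : Set ι) := by
  intro i hi i' hi' h
  obtain ⟨-, hi1, hi2⟩ := Finset.mem_filter.1 (Finset.mem_coe.1 hi)
  obtain ⟨-, hi1', hi2'⟩ := Finset.mem_filter.1 (Finset.mem_coe.1 hi')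
  unfold keyRow at h
  simp only [Prod.mk.injEq] at h
  obtain ⟨e1, e2⟩ := h
  refine hinj i i' ?_ ?_
  · rw [← Nat.div_add_mod (l₁ i) m₁, ← Nat.div_add_mod (l₁ i') m₁, hi1, hi1', e1]
  · rw [← Nat.div_add_mod (l₂ i) m₂, ← Nat.div_add_mod (l₂ i') m₂, hi2, hi2', e2]

/-- Column keys are injective on the offset codes. [folklore] -/
theorem keyCol_injOn (m₁ m₂ : ℕ) :
    Set.InjOn (fun n : Fin (m₁ * m₂) => keyCol m₁ (n : ℕ)) (Finset.univ : Finset (Fin (m₁ * m₂))) := by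
  intro n _ n' _ h
  unfold keyCol at h
  simp only [Prod.mk.injEq] at h
  apply Fin.ext
  rw [← Nat.div_add_mod (n : ℕ) m₁, ← Nat.div_add_mod (n' : ℕ) m₁, h.1, h.2]

omit [Fintype ι] in
/-- Row keys are `< (m₁, m₂)`. [folklore] -/
theorem keyRow_lt (l₁ l₂ : ι → ℕ) {m₁ m₂ : ℕ} (hm₁ : 0 < m₁) (hm₂ : 0 < m₂) (i : ι) :
    (keyRow l₁ l₂ m₁ m₂ i).1 < m₁ ∧ (keyRow l₁ l₂ m₁ m₂ i).2 < m₂ :=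
  ⟨Nat.mod_lt _ hm₁, Nat.mod_lt _ hm₂⟩

/-- Column keys are `< (m₁, m₂)`. [folklore] -/
theorem keyCol_lt {m₁ m₂ : ℕ} (hm₁ : 0 < m₁) (n : Fin (m₁ * m₂)) : (keyCol m₁ (n : ℕ)).1 < m₁ ∧ (keyCol m₁ (n : ℕ)).2 < m₂ := by
  refine ⟨Nat.mod_lt _ hm₁, ?_⟩
  unfold keyCol
  exact (Nat.div_lt_iff_lt_mul hm₁).2 (lt_of_lt_of_eq n.isLt (Nat.mul_comm m₁ m₂))

/-- **Box windows under the keyed rung: `#vert conv ⋃ᵢ (v i + b[box i]) ≤ 4C·m₁m₂·(N₁/m₁ + 1)(N₂/m₂ + 1)`** — no logarithm and no row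
term — when the window corners `(l₁ i, l₂ i)` are pairwise distinct. [folklore] -/
theorem ncard_extremePoints_boxWindows_le_of_keyBound {C : ℕ} (hC : GridDominanceKeyBound C) (b : ℕ × ℕ → (Fin 2 → ℝ))
    (v : ι → (Fin 2 → ℝ)) (l₁ l₂ : ι → ℕ) {m₁ m₂ : ℕ} (hm₁ : 0 < m₁) (hm₂ : 0 < m₂) (N₁ N₂ : ℕ) (hl₁ : ∀ i, l₁ i < N₁)
    (hl₂ : ∀ i, l₂ i < N₂) (hinj : ∀ i i', l₁ i = l₁ i' → l₂ i = l₂ i' → i = i') :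
    (Set.extremePoints ℝ (convexHull ℝ
        (⋃ i, (v i +ᵥ (b '' (Set.Ico (l₁ i) (l₁ i + m₁) ×ˢ Set.Ico (l₂ i) (l₂ i + m₂))))))).ncard ≤
      4 * C * (m₁ * m₂) * ((N₁ / m₁ + 1) * (N₂ / m₂ + 1)) := by
  classical
  set B := Finset.range (N₁ / m₁ + 1) ×ˢ Finset.range (N₂ / m₂ + 1) with hB
  rw [boxWindows_eq_biUnion b v l₁ l₂ hm₁ hm₂ N₁ N₂ hl₁ hl₂]
  refine (ncard_extremePoints_biUnion_le _ _).trans ?_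
  have hpiece : ∀ tp ∈ B ×ˢ (Finset.univ : Finset (Bool × Bool)),
      ((convexHull ℝ (boxPiece b v l₁ l₂ m₁ m₂ tp : Set (Fin 2 → ℝ))).extremePoints ℝ).ncard ≤ C * (m₁ * m₂) := by
    intro tp _
    rw [boxPiece_eq_keyPts b v l₁ l₂ hm₁ hm₂ tp]
    exact hC ι (Fin (m₁ * m₂)) (boxRows l₁ l₂ m₁ m₂ tp.1) Finset.univ (keyRow l₁ l₂ m₁ m₂) (fun n => keyCol m₁ (n : ℕ))
      m₁ m₂ (keyRow_injOn l₁ l₂ m₁ m₂ hinj tp.1) (keyCol_injOn m₁ m₂) (fun i _ => keyRow_lt l₁ l₂ hm₁ hm₂ i)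
      (fun n _ => keyCol_lt hm₁ n) tp.2.1 tp.2.2 v _
  refine (Finset.sum_le_sum hpiece).trans ?_
  rw [Finset.sum_const, smul_eq_mul, Finset.card_product, hB, Finset.card_product, Finset.card_range, Finset.card_range,
    Finset.card_univ, Fintype.card_prod, Fintype.card_bool]
  ring_nf
  rfl

end BoxWin

/-! ### The box stratum under the keyed rung -/

section Box

variable {q₁ q₂ : ℕ} [NeZero q₁] [NeZero q₂]

/-- Window starts are injective in the group element. [folklore] -/
theorem winStart_injective {q : ℕ} [NeZero q] (t m : ℕ) (s : ZMod q) : Function.Injective (winStart t m s) := by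
  intro x y h
  unfold winStart at h
  have h1 := ZMod.val_injective q h
  have h2 : s - x = s - y := by
    have := congrArg (fun z => z + ((m - 1 : ℕ) : ZMod q) + (t : ZMod q)) h1
    simpa using this
  exact sub_right_injective h2

/-- **THE BOX STRATUM IS LOG-FREE UNDER THE KEYED RUNG (raw form):** for `0 < m₁`, `0 < m₂`,
`#vert conv U_s([t₁,t₁+m₁) × [t₂,t₂+m₂)) ≤ 4C·m₁m₂·(q₁/m₁ + 1)(q₂/m₂ + 1)`. [folklore] -/
theorem unionVert_cycBox_le_raw_of_keyBound {C : ℕ} (hC : GridDominanceKeyBound C) (a b : ZMod q₁ × ZMod q₂ → (Fin 2 → ℝ))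
    (t₁ t₂ : ℕ) {m₁ m₂ : ℕ} (hm₁ : 0 < m₁) (hm₂ : 0 < m₂) (s : ZMod q₁ × ZMod q₂) :
    unionVert a b (cycBox q₁ q₂ t₁ t₂ m₁ m₂ : Set (ZMod q₁ × ZMod q₂)) s ≤
      4 * C * (m₁ * m₂) * ((q₁ / m₁ + 1) * (q₂ / m₂ + 1)) := by
  unfold unionVert
  rw [unionPts_cycBox_eq]
  exact BoxWin.ncard_extremePoints_boxWindows_le_of_keyBound hC (fun n : ℕ × ℕ => b ((n.1 : ZMod q₁), (n.2 : ZMod q₂))) a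
    (fun x : ZMod q₁ × ZMod q₂ => winStart t₁ m₁ s.1 x.1) (fun x => winStart t₂ m₂ s.2 x.2) hm₁ hm₂ q₁ q₂
    (fun x => winStart_lt t₁ m₁ s.1 x.1) (fun x => winStart_lt t₂ m₂ s.2 x.2)
    (fun x x' h1 h2 => Prod.ext (winStart_injective t₁ m₁ s.1 h1) (winStart_injective t₂ m₂ s.2 h2))

/-- **THE BOX STRATUM IS LOG-FREE UNDER THE KEYED RUNG:** `GridDominanceKeyBound C` implies
`#vert conv U_s(Z) ≤ 16C·|G|` for every box `Z ⊂ ℤ/q₁ × ℤ/q₂`, every class `s` and all `a b` (vs. `80K|G|`, `K = O(log|G|)`,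
unconditionally in `…TotalsLawBoxUnion`). [folklore] -/
theorem unionVert_cycBox_le_of_keyBound {C : ℕ} (hC : GridDominanceKeyBound C) (a b : ZMod q₁ × ZMod q₂ → (Fin 2 → ℝ))
    (t₁ t₂ m₁ m₂ : ℕ) (s : ZMod q₁ × ZMod q₂) :
    unionVert a b (cycBox q₁ q₂ t₁ t₂ m₁ m₂ : Set (ZMod q₁ × ZMod q₂)) s ≤ 16 * C * (q₁ * q₂) := by
  classical
  have hq₁ : 0 < q₁ := Nat.pos_of_ne_zero (NeZero.ne q₁)
  have hq₂ : 0 < q₂ := Nat.pos_of_ne_zero (NeZero.ne q₂)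
  by_cases h0 : m₁ = 0 ∨ m₂ = 0
  · have hempty : cycBox q₁ q₂ t₁ t₂ m₁ m₂ = ∅ := by
      rcases h0 with h | h <;> simp [cycBox, cycInterval, h]
    unfold unionVert
    rw [hempty, Finset.coe_empty]
    have : unionPts a b (∅ : Set (ZMod q₁ × ZMod q₂)) s = ∅ := by simp [unionPts]
    rw [this, convexHull_empty]
    simp
  push Not at h0
  obtain ⟨hm₁, hm₂⟩ := h0
  wlog hle₁ : m₁ ≤ q₁ generalizing m₁
  · have h := this q₁ (NeZero.ne q₁) le_rfl
    have e : cycBox q₁ q₂ t₁ t₂ m₁ m₂ = cycBox q₁ q₂ t₁ t₂ q₁ m₂ := by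
      rw [cycBox, cycBox, cycInterval_eq_univ_of_le t₁ (le_of_not_ge hle₁), cycInterval_eq_univ_of_le t₁ le_rfl]
    rwa [e]
  wlog hle₂ : m₂ ≤ q₂ generalizing m₂
  · have h := this q₂ (NeZero.ne q₂) le_rfl
    have e : cycBox q₁ q₂ t₁ t₂ m₁ m₂ = cycBox q₁ q₂ t₁ t₂ m₁ q₂ := by
      rw [cycBox, cycBox, cycInterval_eq_univ_of_le t₂ (le_of_not_ge hle₂), cycInterval_eq_univ_of_le t₂ le_rfl]
    rwa [e]
  have hraw := unionVert_cycBox_le_raw_of_keyBound hC a b t₁ t₂ (Nat.pos_of_ne_zero hm₁) (Nat.pos_of_ne_zero hm₂) s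
  have h1 : m₁ * (q₁ / m₁ + 1) ≤ 2 * q₁ := by
    have := Nat.mul_div_le q₁ m₁; rw [Nat.mul_comm] at this; nlinarith
  have h2 : m₂ * (q₂ / m₂ + 1) ≤ 2 * q₂ := by
    have := Nat.mul_div_le q₂ m₂; rw [Nat.mul_comm] at this; nlinarith
  have harea : m₁ * m₂ * ((q₁ / m₁ + 1) * (q₂ / m₂ + 1)) ≤ 4 * (q₁ * q₂) := by
    calc m₁ * m₂ * ((q₁ / m₁ + 1) * (q₂ / m₂ + 1)) = (m₁ * (q₁ / m₁ + 1)) * (m₂ * (q₂ / m₂ + 1)) := by ring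
      _ ≤ (2 * q₁) * (2 * q₂) := Nat.mul_le_mul h1 h2
      _ = 4 * (q₁ * q₂) := by ring
  calc unionVert a b (cycBox q₁ q₂ t₁ t₂ m₁ m₂ : Set (ZMod q₁ × ZMod q₂)) s
      ≤ 4 * C * (m₁ * m₂) * ((q₁ / m₁ + 1) * (q₂ / m₂ + 1)) := hraw
    _ = 4 * C * (m₁ * m₂ * ((q₁ / m₁ + 1) * (q₂ / m₂ + 1))) := by ring
    _ ≤ 4 * C * (4 * (q₁ * q₂)) := Nat.mul_le_mul_left _ harea
    _ = 16 * C * (q₁ * q₂) := by ring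

/-- **Totals under the keyed rung:** `∑_s #vert conv U_s(Z) ≤ 16C·|G|²` for every box `Z`. [folklore] -/
theorem unionTotal_cycBox_le_of_keyBound {C : ℕ} (hC : GridDominanceKeyBound C) (a b : ZMod q₁ × ZMod q₂ → (Fin 2 → ℝ))
    (t₁ t₂ m₁ m₂ : ℕ) :
    unionTotal a b (cycBox q₁ q₂ t₁ t₂ m₁ m₂ : Set (ZMod q₁ × ZMod q₂)) ≤ 16 * C * (q₁ * q₂) ^ 2 := by
  unfold unionTotal
  calc ∑ s, unionVert a b (cycBox q₁ q₂ t₁ t₂ m₁ m₂ : Set (ZMod q₁ × ZMod q₂)) s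
      ≤ ∑ _s : ZMod q₁ × ZMod q₂, 16 * C * (q₁ * q₂) := Finset.sum_le_sum fun s _ => unionVert_cycBox_le_of_keyBound hC a b t₁ t₂ m₁ m₂ s
    _ = _ := by rw [Finset.sum_const, Finset.card_univ, Fintype.card_prod, ZMod.card, ZMod.card, smul_eq_mul]; ring

end Box

end TotalsLaw

end Summit.ValiantsHypothesis.ValiantsHypothesis.Theorems.NewtonUnitEquationsDissociatedUniform
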